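import Literature.AnabelianGeometry.SemiGraphs.PSCRamificationCyclicProofs
import Literature.AnabelianGeometry.SemiGraphs.PSCConjFamilyCharacterization
import HarnessLib

/-!
# [IUTchI] Rmk. 1.2.3 (iv)/(v): the cuspidal and nodal edge-like characterizations REDUCED to [CombGC] Prop. 1.2 (i)

Mochizuki, *Inter-universal Teichmüller theory I* [IUTchI] Rmk. 1.2.3 (iv), (v) (kurims manuscript pp. 41–43;
replacement texts for [CombGC] Rmks. 1.4.3, 1.4.4): "the cuspidal (resp. nodal) edge-like subgroups of `Π_G`
may be characterized as the maximal closed subgroups `A ⊆ Π_G` isomorphic to `ℤ_l` which satisfy the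
following condition: for every characteristic open subgroup `Π_{G'} ⊆ Π_G`, if we write `G' → G'' → G`
for the finite étale coverings corresponding to `Π_{G'} ⊆ Π_{G''} := A · Π_{G'} ⊆ Π_G`, then the cyclic
finite étale covering `G' → G''` is cuspidally (resp. nodally) totally ramified … [(v):] Here, we note
further that … `G' → G''` is nodally totally ramified if and only if it is module-wise nodal" — typed by
abc-iut-L3-t4 as `PSCDatum.CuspidalEdgeLikeCharacterization` / `PSCDatum.NodalEdgeLikeCharacterization`
(`PSCRamification.lean`; abc-iut FACT-LIST rows F-1930/F-1931 and F-1937, origin forms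
`CuspidalEdgeLikeCharacterizationHolds Ω`, `NodalEdgeLikeCharacterizationHolds Ω`, both universal
closures refuted at junk data, `PSCOriginClosureRefutations.lean`).  PROOF-ONLY file (abc-iut-w5-d160,
D-0079 L-F row F-1937; no definitions, no new `Prop`).

## What is proved

Write `cond(A)` for the typed condition (closed, topologically procyclic, infinite, and for every
characteristic open `U` the covering `U ≤ A·U` is nodally — resp. cuspidally — totally ramified in the
typed sense: Galois, and `((A·U) ∩ γΠ_e)·U = A·U` for SOME node — resp. cusp — `e` and some `γ`).  For a
datum `G : PSCDatum Π` over a PROFINITE, TOPOLOGICALLY FINITELY GENERATED, pro-`l` group `Π` we prove the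
printed "one verifies immediately [from Prop. 1.2]": BOTH halves of the typed characterization follow from

* (E) the node (resp. cusp) groups are topologically procyclic and infinite ("`≅ ℤ_l`"), and
* (I) CONTAINMENT DETERMINES THE EDGE: `γΠ_e ≤ δΠ_{e'} ⇒ e = e'` — a special case of [CombGC] Prop. 1.2
  (i), edge-like clause (`EdgeLikeOpenInterDeterminesEdge`, a conjunct of row F-0459
  `OpenInterDeterminesComponentHolds`): `isNodal/isCuspidal_containment_of_edgeLikeOpenInter`.

Steps (`conj_family_characterization`, for an arbitrary finite family `S` of closed subgroups and an
abstract ramification predicate `R`, then specialised): (1) `cond(γ•Π_e)` is AUTOMATIC from (E) — the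
covering `U ≤ Π_e·U` is totally ramified at `e` itself (`((A·U) ∩ A)·U = A·U`); (2) the LIMIT STEP of
abc-iut-f-164's `PSCCuspidalCharacterizationConverse.lean` (compactness of `Π` + cofinality of the
characteristic open subgroups by Serre's theorem, `mem_of_forall_characteristic_mem_sup`), written here for
a finite family: `cond(B) ⇒ B ≤ g•Π_{e'}` for some edge `e'` and some `g` (`exists_le_conj_of_forall_characteristic`);
(3) MAXIMALITY of `γ•Π_e`: a `cond`-subgroup `B ⊇ γ•Π_e` lies in some `g•Π_{e'}`, so `γ•Π_e ≤ g•Π_{e'}`, whence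
`e = e'` by (I) and `γ•Π_e = g•Π_e` because a closed subgroup of a profinite group contained in a conjugate
of itself equals it (`ProfiniteConjugateIndex.conj_smul_eq_self_of_ge`, abc-iut tree); (4) CONVERSE: a
`cond`-maximal `A` lies in some `g•Π_{e'}`, which satisfies `cond` by (1), so `A = g•Π_{e'}`.  No malnormality
/ commensurable-terminality input is used (compare abc-iut-L3-t4's smooth-curve route
`cuspidalEdgeLikeCharacterization_mp_of_smoothCurve`).

Consequences: `nodalEdgeLikeCharacterization_of_containment` (**row F-1937's datum-level statement from
(E)+(I)**; its second conjunct is abc-iut's `nodallyTotallyRamified_iff_modulewiseNodal`, a theorem for every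
datum), `cuspidalEdgeLikeCharacterization_of_containment` (row F-1930 likewise), the unguarded nodal
characterization `isNodal_iff_cond_maximal_of_containment` (meaningful also at cuspidal data, where the typed
F-1937 is vacuous by its `IsNoncuspidal` guard), and the ORIGIN forms **F-1937 ⇐ F-0459 + (E)** and
**F-1931 ⇐ F-0459 + (E)** at every origin of profinite topologically finitely generated data
(`nodalEdgeLikeCharacterizationHolds_of_openInter`, `cuspidalEdgeLikeCharacterizationHolds_of_openInter`).
Instances at genuine two-component data are in the companion `PSCNodalCharacterizationTwoComponent.lean`.
Nothing is asserted about all pointed stable curves; nothing here takes a side on [IUTchIII] Cor. 3.12.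
[cite: Mochizuki2012, IUTchI Rmk 1.2.3(iv)-(v) pp.41-43] [cite: MochizukiCombGC2007, Prop 1.2(i) p.8]
[cite: DDMSAnalyticProP1999, Thm 1.17]
-/

noncomputable section

namespace Literature.AnabelianGeometry.SemiGraphs

namespace PSCDatum

open scoped Pointwise
open Literature.AnabelianGeometry.AbsoluteAnabelian (IsTopologicallyFinitelyGenerated)
open ConjFamily (conj_family_characterization)

universe u

variable {P : Type u} [Group P] [TopologicalSpace P] [IsTopologicalGroup P]

/-! ### The PSC specialisations: nodes and cusps -/

section PSC

variable [CompactSpace P] [TotallyDisconnectedSpace P] (G : PSCDatum P)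

omit [IsTopologicalGroup P] [CompactSpace P] [TotallyDisconnectedSpace P] in
/-- **(I) for nodes from [CombGC] Prop. 1.2 (i), edge-like clause**: if `γ • Π_e ≤ δ • Π_{e'}` for nodes
`e, e'`, then `e = e'` (the intersection `γΠ_e ∩ δΠ_{e'} = γΠ_e` is all of — hence open in — `γΠ_e`).
[cite: MochizukiCombGC2007, Prop 1.2(i) p.8] -/
theorem node_eq_of_conj_le_of_edgeLikeOpenInter (h : G.EdgeLikeOpenInterDeterminesEdge)
    (e e' : G.graph.N) (γ δ : ConjAct P) (hle : γ • G.nodeGp e ≤ δ • G.nodeGp e') : e = e' := by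
  refine Sum.inl_injective (h (Sum.inl e) (Sum.inl e') γ δ ?_)
  have hle' : γ • G.edgeGp (Sum.inl e) ≤ δ • G.edgeGp (Sum.inl e') := hle
  rw [inf_eq_left.mpr hle', Subgroup.subgroupOf_self, Subgroup.coe_top]
  exact isOpen_univ

omit [IsTopologicalGroup P] [CompactSpace P] [TotallyDisconnectedSpace P] in
/-- **(I) for cusps from [CombGC] Prop. 1.2 (i), edge-like clause**: if `γ • Π_c ≤ δ • Π_{c'}` for cusps
`c, c'`, then `c = c'`. [cite: MochizukiCombGC2007, Prop 1.2(i) p.8] -/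
theorem cusp_eq_of_conj_le_of_edgeLikeOpenInter (h : G.EdgeLikeOpenInterDeterminesEdge)
    (c c' : G.graph.C) (γ δ : ConjAct P) (hle : γ • G.cuspGp c ≤ δ • G.cuspGp c') : c = c' := by
  refine Sum.inr_injective (h (Sum.inr c) (Sum.inr c') γ δ ?_)
  have hle' : γ • G.edgeGp (Sum.inr c) ≤ δ • G.edgeGp (Sum.inr c') := hle
  rw [inf_eq_left.mpr hle', Subgroup.subgroupOf_self, Subgroup.coe_top]
  exact isOpen_univ

omit [IsTopologicalGroup P] [CompactSpace P] [TotallyDisconnectedSpace P] in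
/-- The typed ramification clause at a characteristic open `U` puts `A` inside `γ • Π_e · U` (nodal case).
[cite: Mochizuki2012, IUTchI Rmk 1.2.3(v) p.43] -/
theorem le_conj_nodeGp_sup_of_isNodallyTotallyRamified {A U : Subgroup P}
    (h : G.IsNodallyTotallyRamified (A ⊔ U) U) :
    ∃ (e : G.graph.N) (γ : ConjAct P), A ≤ γ • G.nodeGp e ⊔ U := by
  obtain ⟨-, e, γ, heγ⟩ := h
  refine ⟨e, γ, ?_⟩
  calc A ≤ A ⊔ U := le_sup_left
    _ = ((A ⊔ U) ⊓ γ • G.nodeGp e) ⊔ U := heγ.symm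
    _ ≤ γ • G.nodeGp e ⊔ U := sup_le_sup_right inf_le_right U

omit [IsTopologicalGroup P] [CompactSpace P] [TotallyDisconnectedSpace P] in
/-- The typed ramification clause at a characteristic open `U` puts `A` inside `γ • Π_c · U` (cuspidal
case; abc-iut-f-164's step (1)). [cite: Mochizuki2012, IUTchI Rmk 1.2.3(iv) pp.41-42] -/
theorem le_conj_cuspGp_sup_of_isCuspidallyTotallyRamified {A U : Subgroup P}
    (h : G.IsCuspidallyTotallyRamified (A ⊔ U) U) :
    ∃ (c : G.graph.C) (γ : ConjAct P), A ≤ γ • G.cuspGp c ⊔ U := by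
  obtain ⟨-, c, γ, hcγ⟩ := h
  refine ⟨c, γ, ?_⟩
  calc A ≤ A ⊔ U := le_sup_left
    _ = ((A ⊔ U) ⊓ γ • G.cuspGp c) ⊔ U := hcγ.symm
    _ ≤ γ • G.cuspGp c ⊔ U := sup_le_sup_right inf_le_right U

omit [CompactSpace P] [TotallyDisconnectedSpace P] in
/-- **`cond` is automatic at the edge itself (nodal case)**: for every node `e`, every `γ` and every
characteristic open `U`, the covering `U ≤ γΠ_e · U` is nodally totally ramified in the typed sense —
Galois (as `U` is normal and open) and totally ramified at `e`: `((γΠ_e·U) ∩ γΠ_e)·U = γΠ_e·U`.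
[cite: Mochizuki2012, IUTchI Rmk 1.2.3(v) p.43] -/
theorem isNodallyTotallyRamified_conj_nodeGp_sup (e : G.graph.N) (γ : ConjAct P) (U : Subgroup P)
    (hUc : U.Characteristic) (hUo : IsOpen (U : Set P)) :
    G.IsNodallyTotallyRamified (γ • G.nodeGp e ⊔ U) U := by
  haveI := hUc
  refine ⟨⟨le_sup_right, hUo, Subgroup.isOpen_mono le_sup_right hUo,
    (inferInstance : U.Normal).subgroupOf _⟩, e, γ, ?_⟩
  rw [inf_eq_right.mpr le_sup_left]

omit [CompactSpace P] [TotallyDisconnectedSpace P] in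
/-- **`cond` is automatic at the edge itself (cuspidal case)**.
[cite: Mochizuki2012, IUTchI Rmk 1.2.3(iv) pp.41-42] -/
theorem isCuspidallyTotallyRamified_conj_cuspGp_sup (c : G.graph.C) (γ : ConjAct P) (U : Subgroup P)
    (hUc : U.Characteristic) (hUo : IsOpen (U : Set P)) :
    G.IsCuspidallyTotallyRamified (γ • G.cuspGp c ⊔ U) U := by
  haveI := hUc
  refine ⟨⟨le_sup_right, hUo, Subgroup.isOpen_mono le_sup_right hUo,
    (inferInstance : U.Normal).subgroupOf _⟩, c, γ, ?_⟩
  rw [inf_eq_right.mpr le_sup_left]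

/-- **The nodal characterization, unguarded, from (E) + (I).**  Over a profinite, topologically finitely
generated, pro-`p` group `Π`: if the node groups are topologically procyclic and infinite and containment
between conjugates of node groups determines the node, then a subgroup `A` is nodal iff it satisfies the
typed condition of [IUTchI] Rmk. 1.2.3 (v) and is maximal for it.  (Meaningful at cuspidal data too, where
the typed row F-1937 is vacuous by its `IsNoncuspidal` guard.) [cite: Mochizuki2012, IUTchI Rmk 1.2.3(v) p.43] -/
theorem isNodal_iff_cond_maximal_of_containment {p : ℕ} [Fact p.Prime]
    (hP : ∀ U : OpenNormalSubgroup P, IsPGroup p (P ⧸ (U : Subgroup P)))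
    (htfg : IsTopologicallyFinitelyGenerated P)
    (hcyc : ∀ e : G.graph.N, ∃ a : P, (Subgroup.zpowers a).topologicalClosure = G.nodeGp e)
    (hinf : ∀ e : G.graph.N, (G.nodeGp e : Set P).Infinite)
    (hinc : ∀ (e e' : G.graph.N) (γ δ : ConjAct P), γ • G.nodeGp e ≤ δ • G.nodeGp e' → e = e')
    (A : Subgroup P) :
    G.IsNodal A ↔
      ((IsClosed (A : Set P) ∧ (∃ a : P, (Subgroup.zpowers a).topologicalClosure = A) ∧
          (A : Set P).Infinite ∧
          ∀ U : Subgroup P, U.Characteristic → IsOpen (U : Set P) →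
            G.IsNodallyTotallyRamified (A ⊔ U) U) ∧
        ∀ B : Subgroup P,
          (IsClosed (B : Set P) ∧ (∃ b : P, (Subgroup.zpowers b).topologicalClosure = B) ∧
              (B : Set P).Infinite ∧
              ∀ U : Subgroup P, U.Characteristic → IsOpen (U : Set P) →
                G.IsNodallyTotallyRamified (B ⊔ U) U) →
            A ≤ B → A = B) :=
  conj_family_characterization G.nodeGp G.isClosed_nodeGp hP htfg hcyc hinf hinc
    G.IsNodallyTotallyRamified (fun _ _ _ _ h => G.le_conj_nodeGp_sup_of_isNodallyTotallyRamified h)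
    (fun e γ U hUc hUo => G.isNodallyTotallyRamified_conj_nodeGp_sup e γ U hUc hUo) A

/-- **The cuspidal characterization from (E) + (I)** (same statement for cusps).
[cite: Mochizuki2012, IUTchI Rmk 1.2.3(iv) pp.41-42] -/
theorem isCuspidal_iff_cond_maximal_of_containment {p : ℕ} [Fact p.Prime]
    (hP : ∀ U : OpenNormalSubgroup P, IsPGroup p (P ⧸ (U : Subgroup P)))
    (htfg : IsTopologicallyFinitelyGenerated P)
    (hcyc : ∀ c : G.graph.C, ∃ a : P, (Subgroup.zpowers a).topologicalClosure = G.cuspGp c)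
    (hinf : ∀ c : G.graph.C, (G.cuspGp c : Set P).Infinite)
    (hinc : ∀ (c c' : G.graph.C) (γ δ : ConjAct P), γ • G.cuspGp c ≤ δ • G.cuspGp c' → c = c')
    (A : Subgroup P) :
    G.IsCuspidal A ↔
      ((IsClosed (A : Set P) ∧ (∃ a : P, (Subgroup.zpowers a).topologicalClosure = A) ∧
          (A : Set P).Infinite ∧
          ∀ U : Subgroup P, U.Characteristic → IsOpen (U : Set P) →
            G.IsCuspidallyTotallyRamified (A ⊔ U) U) ∧
        ∀ B : Subgroup P,
          (IsClosed (B : Set P) ∧ (∃ b : P, (Subgroup.zpowers b).topologicalClosure = B) ∧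
              (B : Set P).Infinite ∧
              ∀ U : Subgroup P, U.Characteristic → IsOpen (U : Set P) →
                G.IsCuspidallyTotallyRamified (B ⊔ U) U) →
            A ≤ B → A = B) :=
  conj_family_characterization G.cuspGp G.isClosed_cuspGp hP htfg hcyc hinf hinc
    G.IsCuspidallyTotallyRamified
    (fun _ _ _ _ h => G.le_conj_cuspGp_sup_of_isCuspidallyTotallyRamified h)
    (fun c γ U hUc hUo => G.isCuspidallyTotallyRamified_conj_cuspGp_sup c γ U hUc hUo) A

/-- **Row F-1937 at the datum level from (E) + (I): [IUTchI] Rmk. 1.2.3 (v) as typed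
(`NodalEdgeLikeCharacterization`)** holds for every datum over a profinite, topologically finitely generated
group whose node groups are topologically procyclic and infinite and for which containment between
conjugates of node groups determines the node (the pro-`l`-ness needed by Serre's theorem is the datum's
field `proSigma` at `Σ = {l}`; the second conjunct "nodally totally ramified iff module-wise nodal" is the
tree's `nodallyTotallyRamified_iff_modulewiseNodal`, a theorem for every datum).
[cite: Mochizuki2012, IUTchI Rmk 1.2.3(v) p.43] -/
theorem nodalEdgeLikeCharacterization_of_containment (htfg : IsTopologicallyFinitelyGenerated P)
    (hcyc : ∀ e : G.graph.N, ∃ a : P, (Subgroup.zpowers a).topologicalClosure = G.nodeGp e)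
    (hinf : ∀ e : G.graph.N, (G.nodeGp e : Set P).Infinite)
    (hinc : ∀ (e e' : G.graph.N) (γ δ : ConjAct P), γ • G.nodeGp e ≤ δ • G.nodeGp e' → e = e') :
    G.NodalEdgeLikeCharacterization := by
  intro hnc l hSl
  dsimp only
  haveI : Fact l.Prime := ⟨G.sigma_prime l (by rw [hSl]; exact Set.mem_singleton l)⟩
  have hpro : IsProSigma {l} P := hSl ▸ G.proSigma
  have hP : ∀ U : OpenNormalSubgroup P, IsPGroup l (P ⧸ (U : Subgroup P)) :=
    fun U => isPGroup_quotient_of_isProSigma_singleton hpro U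
  exact ⟨fun A => G.isNodal_iff_cond_maximal_of_containment hP htfg hcyc hinf hinc A,
    G.nodallyTotallyRamified_iff_modulewiseNodal hnc hSl⟩

/-- **Row F-1930 at the datum level from (E) + (I): [IUTchI] Rmk. 1.2.3 (iv), cuspidal part, as typed
(`CuspidalEdgeLikeCharacterization`)** holds for every datum over a profinite, topologically finitely
generated group whose cusp groups are topologically procyclic and infinite and for which containment
between conjugates of cusp groups determines the cusp.
[cite: Mochizuki2012, IUTchI Rmk 1.2.3(iv) pp.41-42] -/
theorem cuspidalEdgeLikeCharacterization_of_containment (htfg : IsTopologicallyFinitelyGenerated P)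
    (hcyc : ∀ c : G.graph.C, ∃ a : P, (Subgroup.zpowers a).topologicalClosure = G.cuspGp c)
    (hinf : ∀ c : G.graph.C, (G.cuspGp c : Set P).Infinite)
    (hinc : ∀ (c c' : G.graph.C) (γ δ : ConjAct P), γ • G.cuspGp c ≤ δ • G.cuspGp c' → c = c') :
    G.CuspidalEdgeLikeCharacterization := by
  intro l hSl
  dsimp only
  intro A
  haveI : Fact l.Prime := ⟨G.sigma_prime l (by rw [hSl]; exact Set.mem_singleton l)⟩
  have hpro : IsProSigma {l} P := hSl ▸ G.proSigma
  have hP : ∀ U : OpenNormalSubgroup P, IsPGroup l (P ⧸ (U : Subgroup P)) :=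
    fun U => isPGroup_quotient_of_isProSigma_singleton hpro U
  exact G.isCuspidal_iff_cond_maximal_of_containment hP htfg hcyc hinf hinc A

/-- **Row F-1937 at the datum level from [CombGC] Prop. 1.2 (i) (edge-like clause) + (E).**
[cite: Mochizuki2012, IUTchI Rmk 1.2.3(v) p.43] -/
theorem nodalEdgeLikeCharacterization_of_edgeLikeOpenInter (htfg : IsTopologicallyFinitelyGenerated P)
    (hcyc : ∀ e : G.graph.N, ∃ a : P, (Subgroup.zpowers a).topologicalClosure = G.nodeGp e)
    (hinf : ∀ e : G.graph.N, (G.nodeGp e : Set P).Infinite) (h12 : G.EdgeLikeOpenInterDeterminesEdge) :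
    G.NodalEdgeLikeCharacterization :=
  G.nodalEdgeLikeCharacterization_of_containment htfg hcyc hinf
    (G.node_eq_of_conj_le_of_edgeLikeOpenInter h12)

/-- **Row F-1930 at the datum level from [CombGC] Prop. 1.2 (i) (edge-like clause) + (E).**
[cite: Mochizuki2012, IUTchI Rmk 1.2.3(iv) pp.41-42] -/
theorem cuspidalEdgeLikeCharacterization_of_edgeLikeOpenInter (htfg : IsTopologicallyFinitelyGenerated P)
    (hcyc : ∀ c : G.graph.C, ∃ a : P, (Subgroup.zpowers a).topologicalClosure = G.cuspGp c)
    (hinf : ∀ c : G.graph.C, (G.cuspGp c : Set P).Infinite) (h12 : G.EdgeLikeOpenInterDeterminesEdge) :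
    G.CuspidalEdgeLikeCharacterization :=
  G.cuspidalEdgeLikeCharacterization_of_containment htfg hcyc hinf
    (G.cusp_eq_of_conj_le_of_edgeLikeOpenInter h12)

end PSC

/-! ### Origin level: F-1937 ⇐ F-0459 + (E) and F-1931 ⇐ F-0459 + (E) -/

section Origin

variable (Ω : PSCOrigin.{u})

/-- **Row F-1937 (`NodalEdgeLikeCharacterizationHolds Ω`) FROM row F-0459 ([CombGC] Prop. 1.2 (i),
`OpenInterDeterminesComponentHolds Ω`) at every origin of profinite, topologically finitely generated data
whose node groups are topologically procyclic and infinite.** [cite: Mochizuki2012, IUTchI Rmk 1.2.3(v) p.43] -/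
theorem nodalEdgeLikeCharacterizationHolds_of_openInter
    (hprof : ∀ ⦃Q : Type u⦄ [Group Q] [TopologicalSpace Q] [IsTopologicalGroup Q] (G : PSCDatum Q),
      Ω.IsOfPSCType G →
        CompactSpace Q ∧ TotallyDisconnectedSpace Q ∧ IsTopologicallyFinitelyGenerated Q ∧
          (∀ e : G.graph.N, ∃ a : Q, (Subgroup.zpowers a).topologicalClosure = G.nodeGp e) ∧
          ∀ e : G.graph.N, (G.nodeGp e : Set Q).Infinite)
    (h12 : OpenInterDeterminesComponentHolds Ω) :
    NodalEdgeLikeCharacterizationHolds Ω := by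
  intro Q _ _ _ G hG
  obtain ⟨hc, hd, htfg, hcyc, hinf⟩ := hprof G hG
  exact G.nodalEdgeLikeCharacterization_of_edgeLikeOpenInter htfg hcyc hinf (h12 G hG).2.1

/-- **Row F-1931 (`CuspidalEdgeLikeCharacterizationHolds Ω`) FROM row F-0459 at every origin of profinite,
topologically finitely generated data whose cusp groups are topologically procyclic and infinite.**
[cite: Mochizuki2012, IUTchI Rmk 1.2.3(iv) pp.41-42] -/
theorem cuspidalEdgeLikeCharacterizationHolds_of_openInter
    (hprof : ∀ ⦃Q : Type u⦄ [Group Q] [TopologicalSpace Q] [IsTopologicalGroup Q] (G : PSCDatum Q),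
      Ω.IsOfPSCType G →
        CompactSpace Q ∧ TotallyDisconnectedSpace Q ∧ IsTopologicallyFinitelyGenerated Q ∧
          (∀ c : G.graph.C, ∃ a : Q, (Subgroup.zpowers a).topologicalClosure = G.cuspGp c) ∧
          ∀ c : G.graph.C, (G.cuspGp c : Set Q).Infinite)
    (h12 : OpenInterDeterminesComponentHolds Ω) :
    CuspidalEdgeLikeCharacterizationHolds Ω := by
  intro Q _ _ _ G hG
  obtain ⟨hc, hd, htfg, hcyc, hinf⟩ := hprof G hG
  exact G.cuspidalEdgeLikeCharacterization_of_edgeLikeOpenInter htfg hcyc hinf (h12 G hG).2.1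

/-- **Rows F-1937 and F-1931 FROM the containment property (I) alone** (no other clause of Prop. 1.2 (i)),
at every origin of profinite, topologically finitely generated data with procyclic infinite edge groups.
[cite: Mochizuki2012, IUTchI Rmk 1.2.3(iv)-(v) pp.41-43] -/
theorem nodal_and_cuspidalEdgeLikeCharacterizationHolds_of_containment
    (hprof : ∀ ⦃Q : Type u⦄ [Group Q] [TopologicalSpace Q] [IsTopologicalGroup Q] (G : PSCDatum Q),
      Ω.IsOfPSCType G →
        CompactSpace Q ∧ TotallyDisconnectedSpace Q ∧ IsTopologicallyFinitelyGenerated Q ∧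
          (∀ e : G.graph.N, ∃ a : Q, (Subgroup.zpowers a).topologicalClosure = G.nodeGp e) ∧
          (∀ e : G.graph.N, (G.nodeGp e : Set Q).Infinite) ∧
          (∀ (e e' : G.graph.N) (γ δ : ConjAct Q), γ • G.nodeGp e ≤ δ • G.nodeGp e' → e = e') ∧
          (∀ c : G.graph.C, ∃ a : Q, (Subgroup.zpowers a).topologicalClosure = G.cuspGp c) ∧
          (∀ c : G.graph.C, (G.cuspGp c : Set Q).Infinite) ∧
          ∀ (c c' : G.graph.C) (γ δ : ConjAct Q), γ • G.cuspGp c ≤ δ • G.cuspGp c' → c = c') :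
    NodalEdgeLikeCharacterizationHolds Ω ∧ CuspidalEdgeLikeCharacterizationHolds Ω := by
  refine ⟨fun Q _ _ _ G hG => ?_, fun Q _ _ _ G hG => ?_⟩
  · obtain ⟨hc, hd, htfg, hcyc, hinf, hinc, -⟩ := hprof G hG
    exact G.nodalEdgeLikeCharacterization_of_containment htfg hcyc hinf hinc
  · obtain ⟨hc, hd, htfg, -, -, -, hcyc, hinf, hinc⟩ := hprof G hG
    exact G.cuspidalEdgeLikeCharacterization_of_containment htfg hcyc hinf hinc

end Origin

end PSCDatum

end Literature.AnabelianGeometry.SemiGraphs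

end
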